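import Mathlib

/-!
# SoloBlind kernel #135 — per-mode cores of the Wei–Zhang–Zhao K-inequalities on the odd class

Paper §24.87(9)(b),(d) (claim SB-C811).  In the enhanced-dissipation proof for the Kolmogorov
flow with the nonlocal term (Wei–Zhang–Zhao, arXiv:1711.01822, Lemma 11.4) the functionals
`K₁ = ⟨ω, ω − ψ⟩`, `K₂ = ⟨(α² − ∂²)ω, ω − ψ⟩`, `K₃ = ⟨ψ, ω − ψ⟩` with `(α² − ∂_y²)ψ = ω` are
DIAGONAL in the Fourier basis in `y`: on the mode `j` (with `ψ_j` normalised to `1`) they read,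
with `m := j² + α²` (so `ω_j = m`),
`K₁ = m² − m`, `K₂ = m²(m − 1)`, `K₃ = m − 1`.
The paper's hypothesis `|α| > 1` serves to make `m ≥ 1` on the mean mode `j = 0`; on the ODD
class (`j ≥ 1`, the standing-pattern class `X^sym_n`) `m ≥ 1` holds for EVERY `α`, and the four
inequalities `K₃ ≥ 0`, `K₁ ≥ α² K₃`, `K₂ ≥ α² K₁`, `K₂ K₃ ≥ K₁²` hold mode by mode — these are the
real-number cores below, together with the odd-class frame constant `α²/(1+α²)` replacing
`1 − α⁻²` and the odd Poincaré constant `1 + α²`.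
-/

namespace Summit.AnomalousDissipation.AnomalousDissipation.Theorems

/-- On the odd class every mode has `m = j² + α² ≥ 1` (for any real `α`), given `1 ≤ j`. -/
theorem oddK_m_ge_one (j α : ℝ) (hj : 1 ≤ j) : 1 ≤ j ^ 2 + α ^ 2 := by
  nlinarith [sq_nonneg α]

/-- `K₃ = m − 1 ≥ 0` whenever `m ≥ 1`. -/
theorem oddK_K3_nonneg (m : ℝ) (hm : 1 ≤ m) : 0 ≤ m - 1 := by linarith

/-- `K₁ − α² K₃ = (m − 1)(m − α²) = (m − 1) j² ≥ 0` per mode (`m = j² + α² ≥ 1`). -/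
theorem oddK_K1_ge_K3 (j α : ℝ) (hm : 1 ≤ j ^ 2 + α ^ 2) :
    α ^ 2 * ((j ^ 2 + α ^ 2) - 1) ≤ (j ^ 2 + α ^ 2) ^ 2 - (j ^ 2 + α ^ 2) := by
  have h1 : 0 ≤ (j ^ 2 + α ^ 2) - 1 := by linarith
  have h2 : 0 ≤ j ^ 2 := sq_nonneg j
  nlinarith [mul_nonneg h1 h2]

/-- `K₂ − α² K₁ = m (m − 1)(m − α²) = m (m − 1) j² ≥ 0` per mode (`m = j² + α² ≥ 1`). -/
theorem oddK_K2_ge_K1 (j α : ℝ) (hm : 1 ≤ j ^ 2 + α ^ 2) :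
    α ^ 2 * ((j ^ 2 + α ^ 2) ^ 2 - (j ^ 2 + α ^ 2)) ≤
      (j ^ 2 + α ^ 2) ^ 2 * ((j ^ 2 + α ^ 2) - 1) := by
  have h0 : 0 ≤ j ^ 2 + α ^ 2 := by positivity
  have h1 : 0 ≤ (j ^ 2 + α ^ 2) - 1 := by linarith
  have h2 : 0 ≤ j ^ 2 := sq_nonneg j
  have key : (j ^ 2 + α ^ 2) ^ 2 * ((j ^ 2 + α ^ 2) - 1) - α ^ 2 * ((j ^ 2 + α ^ 2) ^ 2
      - (j ^ 2 + α ^ 2)) = (j ^ 2 + α ^ 2) * ((j ^ 2 + α ^ 2) - 1) * j ^ 2 := by ring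
  nlinarith [mul_nonneg (mul_nonneg h0 h1) h2, key]

/-- `K₂ K₃ ≥ K₁²` per mode: `m²(m − 1)·(m − 1) = (m² − m)²` — equality mode by mode (the
inequality for superpositions is Cauchy–Schwarz). -/
theorem oddK_K2K3_eq_K1sq (m : ℝ) : m ^ 2 * (m - 1) * (m - 1) = (m ^ 2 - m) ^ 2 := by ring

/-- The full-circle failure that `|α| > 1` repairs: on the mean mode `j = 0` with `|α| < 1`
(`m = α² < 1`) one has `K₃ = m − 1 < 0`. -/
theorem meanMode_K3_neg (α : ℝ) (hα : α ^ 2 < 1) : (0 : ℝ) ^ 2 + α ^ 2 - 1 < 0 := by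
  nlinarith

/-- Odd-class frame constant of the wave operator: `1 − 1/m ≥ α²/(1 + α²)` for every mode
`m = j² + α²` with `j ≥ 1` (replacing the full-circle constant `1 − α⁻²`). -/
theorem oddK_frame_const (j α : ℝ) (hj : 1 ≤ j) :
    α ^ 2 / (1 + α ^ 2) ≤ 1 - 1 / (j ^ 2 + α ^ 2) := by
  have hm : 1 + α ^ 2 ≤ j ^ 2 + α ^ 2 := by nlinarith
  have h1 : 0 < 1 + α ^ 2 := by positivity
  have h2 : 0 < j ^ 2 + α ^ 2 := lt_of_lt_of_le h1 hm
  rw [div_le_iff₀ h1]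
  have h3 : 1 / (j ^ 2 + α ^ 2) ≤ 1 / (1 + α ^ 2) := one_div_le_one_div_of_le h1 hm
  have h4 : (1 - 1 / (j ^ 2 + α ^ 2)) * (1 + α ^ 2) ≥ (1 - 1 / (1 + α ^ 2)) * (1 + α ^ 2) := by
    apply mul_le_mul_of_nonneg_right _ h1.le
    linarith
  have h5 : (1 - 1 / (1 + α ^ 2)) * (1 + α ^ 2) = α ^ 2 := by
    field_simp
    ring
  linarith [h4, h5]

/-- Odd-class Poincaré constant: every mode `j ≥ 1` of a sine series satisfies
`(1 + k²) b² ≤ (j² + k²) b²` — the Stokes block on `X^sym_n` is bounded by `Re/(1 + k²)`. -/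
theorem odd_poincare_mode (j k b : ℝ) (hj : 1 ≤ j) :
    (1 + k ^ 2) * b ^ 2 ≤ (j ^ 2 + k ^ 2) * b ^ 2 := by
  apply mul_le_mul_of_nonneg_right _ (sq_nonneg b)
  nlinarith

/-- … summed over finitely many modes. -/
theorem odd_poincare_sum {ι : Type*} (s : Finset ι) (j b : ι → ℝ) (k : ℝ)
    (hj : ∀ i ∈ s, 1 ≤ j i) :
    (1 + k ^ 2) * ∑ i ∈ s, b i ^ 2 ≤ ∑ i ∈ s, (j i ^ 2 + k ^ 2) * b i ^ 2 := by
  rw [Finset.mul_sum]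
  exact Finset.sum_le_sum fun i hi => odd_poincare_mode (j i) k (b i) (hj i hi)

end Summit.AnomalousDissipation.AnomalousDissipation.Theorems
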